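import Literature.MathematicalPhysics.QuantumFieldTheory.Balaban1983to89.StrongCouplingTorusWindow
import HarnessLib

/-!
# Robust ball (Y2) — the two-sided cycle eigenvector on `ℤ/M` and the doubled torus coordinates (combinatorial lemmas for the axis-rate
# torus clustering `TorusAxisClustering`)

HONEST FRAMING: venture file of the cell `pub-ymgap` (QuantumFields programme), track ROBUST-BALL, seat rb-p2 (g10).  Elementary real / `ZMod`
bookkeeping, no measure theory, no gauge group, no number; nothing continuum / Clay.
CONTENT. (1) `exists_cycleProfile_twoSided`: the cycle eigenvector `g(k) = θ^{val k} + θ^{M − val k}` on `ℤ/M` (`M ≥ 3`, `0 < θ ≤ 1`) — positive, `g(0) ≥ 1`,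
`g(k+1) + g(k−1) ≤ (θ+θ⁻¹) g(k)` at EVERY `k`, one-step ratios `≤ θ⁻¹`, and the TWO-SIDED decay `g(k) ≤ 2θ^j` for `j ≤ val k ≤ M − j` (the slab file
`SlabAxisCriterion.exists_cycleProfile` exports one-sided decay only); `profile_add_int_le` (shifts cost `θ⁻¹^{|u|}`), `profile_intCast_le` (decay at an
integer representative).  (2) Torus coordinates: `le_abs_val_sub_of_le_valMinAbs` (cyclic distance `≥ n` ⇒ the integer difference of representatives `δ`
has `n ≤ |δ| ≤ L − n`), `hc_sub_eq_intCast` (the doubled coordinates `H_i = 2 val(x_i) + [dir = i] ∈ ℤ/2L` of two links differ by the cast of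
`2δ + [dir x = i] − [dir y = i]`), `exists_hc_eq_add_of_torusNorm_le` (links within torus distance `r'` have `H_i` differing by an integer `|u| ≤ 2r'+1`).

## References
* H. Föllmer, LNM 1362 (1988), Ch. I (2.7)–(2.10) (supersolutions); the tree: `SlabAxisCriterion`, `TorusAxisProfile`, `TorusPlaquetteNeighbours`.
-/

noncomputable section

open Finset Function Real
open Literature.MathematicalPhysics.QuantumFieldTheory
open Literature.MathematicalPhysics.QuantumFieldTheory.Balaban1983to89.StrongCouplingTorusWindow

namespace Summit.Ventures.YMGap.RobustBall.TorusAxis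

/-! ### The cycle eigenvector on `ℤ/M`, two-sided interface -/

section Cycle

variable {M : ℕ} [NeZero M]

/-- `val (k + 1) = (val k + 1) mod M`. [folklore] -/
theorem val_add_one_mod (hM : 1 < M) (k : ZMod M) : (k + 1).val = (k.val + 1) % M := by
  haveI : Fact (1 < M) := ⟨hM⟩
  rw [ZMod.val_add, ZMod.val_one]

/-- `val (k + 2) = (val k + 2) mod M`. [folklore] -/
theorem val_add_two_mod (hM : 1 < M) (k : ZMod M) : (k + 2).val = (k.val + 2) % M := by
  rw [show k + 2 = k + 1 + 1 by ring, val_add_one_mod hM, val_add_one_mod hM]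
  conv_rhs => rw [show k.val + 2 = k.val + 1 + 1 from rfl, Nat.add_mod (k.val + 1) 1 M, Nat.mod_eq_of_lt hM]

/-- **The cycle eigenvector** `g(k) = θ^{val k} + θ^{M − val k}` on `ℤ/M` (`M ≥ 3`, `0 < θ ≤ 1`): positive, `g(0) ≥ 1`, a supersolution of the
nearest-neighbour recursion `g(k+1) + g(k−1) ≤ (θ + θ⁻¹) g(k)` at EVERY `k` (equality off `0`), one-step ratios `≤ θ⁻¹`, and the two-sided decay
`g(k) ≤ 2θ^j` whenever `j ≤ val k ≤ M − j`.  (Adapted from `SlabAxisProfile.exists_cycleProfile`, which exports one-sided decay only.) [folklore] -/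
theorem exists_cycleProfile_twoSided (hM : 3 ≤ M) {θ : ℝ} (hθ0 : 0 < θ) (hθ1 : θ ≤ 1) :
    ∃ g : ZMod M → ℝ, (∀ k, 0 < g k) ∧ 1 ≤ g 0 ∧
      (∀ k : ZMod M, g (k + 1) + g (k - 1) ≤ (θ + θ⁻¹) * g k) ∧
      (∀ k : ZMod M, g (k + 1) ≤ θ⁻¹ * g k) ∧ (∀ k : ZMod M, g (k - 1) ≤ θ⁻¹ * g k) ∧
      (∀ (k : ZMod M) (j : ℕ), j ≤ k.val → j + k.val ≤ M → g k ≤ 2 * θ ^ j) := by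
  set g : ZMod M → ℝ := fun k => θ ^ k.val + θ ^ (M - k.val) with hg
  have hM1 : 1 < M := by omega
  have hθinv : θ * θ⁻¹ = 1 := mul_inv_cancel₀ hθ0.ne'
  have hmono : ∀ a b : ℕ, a ≤ b → θ ^ b ≤ θ ^ a := fun a b hab => pow_le_pow_of_le_one hθ0.le hθ1 hab
  have hpow1 : ∀ m : ℕ, θ ^ m ≤ 1 := fun m => pow_le_one₀ hθ0.le hθ1
  -- one-step ratios: `θ g(k+1) ≤ g(k)` and `θ g(k) ≤ g(k+1)`
  have hstep : ∀ k : ZMod M, θ * g (k + 1) ≤ g k ∧ θ * g k ≤ g (k + 1) := by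
    intro k
    have hm : k.val < M := ZMod.val_lt k
    simp only [hg]
    rw [val_add_one_mod hM1 k]
    set m := k.val with hmdef
    rcases Nat.lt_or_ge (m + 1) M with h1 | h1
    · rw [Nat.mod_eq_of_lt h1]
      have e1 : θ * θ ^ (M - (m + 1)) = θ ^ (M - m) := by rw [← pow_succ']; congr 1; omega
      have e2 : θ * θ ^ (m + 1) = θ ^ (m + 2) := by rw [← pow_succ']
      have e3 : θ * θ ^ m = θ ^ (m + 1) := by rw [← pow_succ']
      have e4 : θ * θ ^ (M - m) = θ ^ (M - m + 1) := by rw [← pow_succ']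
      constructor
      · rw [mul_add, e1, e2]; linarith [hmono m (m + 2) (by omega)]
      · rw [mul_add, e3, e4]; linarith [hmono (M - (m + 1)) (M - m + 1) (by omega)]
    · rw [show m + 1 = M by omega, Nat.mod_self]
      simp only [Nat.sub_zero, pow_zero]
      have e1 : θ * θ ^ M = θ ^ (M + 1) := by rw [← pow_succ']
      have e2 : θ ^ (M - m) = θ := by rw [show M - m = 1 by omega, pow_one]
      have e3 : θ * θ ^ m = θ ^ M := by rw [← pow_succ']; congr 1; omega
      constructor
      · rw [mul_add, mul_one, e1, e2]; linarith [hmono m (M + 1) (by omega)]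
      · rw [mul_add, e2, e3]; nlinarith [hmono 0 2 (by omega), pow_nonneg hθ0.le M]
  refine ⟨g, fun k => by positivity, by simp only [hg, ZMod.val_zero, pow_zero, Nat.sub_zero]; linarith [pow_nonneg hθ0.le M],
    fun k => ?_, fun k => ?_, fun k => ?_, fun k j hj hjM => ?_⟩
  · -- the neighbour inequality, parametrised by `j = k - 1`, `m = j.val`
    set j : ZMod M := k - 1 with hj
    have hk : k = j + 1 := by rw [hj]; ring
    have hk1 : k + 1 = j + 2 := by rw [hj]; ring
    have hm : j.val < M := ZMod.val_lt j
    have hkv : k.val = (j.val + 1) % M := by rw [hk]; exact val_add_one_mod hM1 j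
    have hk1v : (k + 1).val = (j.val + 2) % M := by rw [hk1]; exact val_add_two_mod hM1 j
    simp only [hg]
    rw [hkv, hk1v]
    set m := j.val with hmdef
    rcases Nat.lt_or_ge (m + 2) M with h3 | h3
    · rw [Nat.mod_eq_of_lt (by omega : m + 1 < M), Nat.mod_eq_of_lt h3]
      set a := θ ^ m with ha
      set b := θ ^ (M - m - 2) with hb
      have e1 : θ ^ (M - m) = b * θ ^ 2 := by rw [hb, ← pow_add]; congr 1; omega
      have e2 : θ ^ (m + 1) = a * θ := by rw [ha, pow_succ]
      have e3 : θ ^ (M - (m + 1)) = b * θ := by rw [hb, ← pow_succ]; congr 1; omega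
      have e4 : θ ^ (m + 2) = a * θ ^ 2 := by rw [ha, ← pow_add]
      have e5 : θ ^ (M - (m + 2)) = b := by rw [hb]; congr 1
      rw [e1, e2, e3, e4, e5]
      have : (θ + θ⁻¹) * (a * θ + b * θ) = a * θ ^ 2 + b * θ ^ 2 + a * (θ * θ⁻¹) + b * (θ * θ⁻¹) := by ring
      rw [this, hθinv]
      linarith
    · rcases Nat.lt_or_ge (m + 1) M with h4 | h4
      · have hmM : m = M - 2 := by omega
        rw [Nat.mod_eq_of_lt h4, show m + 2 = M by omega, Nat.mod_self]
        simp only [Nat.sub_zero, pow_zero]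
        set b := θ ^ m with hb
        have e1 : θ ^ (M - m) = θ ^ 2 := by rw [show M - m = 2 by omega]
        have e2 : θ ^ (m + 1) = b * θ := by rw [hb, pow_succ]
        have e3 : θ ^ (M - (m + 1)) = θ := by rw [show M - (m + 1) = 1 by omega, pow_one]
        have e4 : θ ^ M = b * θ ^ 2 := by rw [hb, ← pow_add]; congr 1; omega
        rw [e1, e2, e3, e4]
        have : (θ + θ⁻¹) * (b * θ + θ) = b * θ ^ 2 + θ ^ 2 + b * (θ * θ⁻¹) + θ * θ⁻¹ := by ring
        rw [this, hθinv]
        linarith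
      · have hmM : m = M - 1 := by omega
        rw [show m + 1 = M by omega, Nat.mod_self, show m + 2 = M + 1 by omega, Nat.add_mod_left,
          Nat.mod_eq_of_lt (by omega : 1 < M)]
        simp only [Nat.sub_zero, pow_zero, pow_one]
        set b := θ ^ (M - 2) with hb
        have e1 : θ ^ (M - 1) = b * θ := by rw [hb, ← pow_succ]; congr 1; omega
        have e2 : θ ^ m = b * θ := by rw [hmM, e1]
        have e3 : θ ^ (M - m) = θ := by rw [show M - m = 1 by omega, pow_one]
        have e4 : θ ^ M = b * θ ^ 2 := by rw [hb, ← pow_add]; congr 1; omega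
        rw [e1, e2, e3, e4]
        have : (θ + θ⁻¹) * (1 + b * θ ^ 2) = θ + b * θ ^ 3 + θ⁻¹ + b * θ * (θ * θ⁻¹) := by ring
        rw [this, hθinv, mul_one]
        have hb1 : b ≤ 1 := hpow1 _
        have hb0 : 0 ≤ b := by positivity
        have hθ2 : θ ^ 2 ≤ 1 := hpow1 2
        have key : θ * (θ + b * θ) ≤ θ * (θ⁻¹ + b * θ ^ 3) := by
          have : θ * (θ⁻¹ + b * θ ^ 3) = 1 + b * θ ^ 4 := by rw [mul_add, hθinv]; ring
          rw [this]
          nlinarith [mul_nonneg hb0 (sub_nonneg.2 hθ2), mul_nonneg (sub_nonneg.2 hb1) (sub_nonneg.2 hθ2),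
            pow_nonneg hθ0.le 2]
        have := le_of_mul_le_mul_left key hθ0
        linarith
  · rw [← div_eq_inv_mul]; exact (le_div_iff₀' hθ0).2 (hstep k).1
  · rw [← div_eq_inv_mul]
    have h := (hstep (k - 1)).2
    rw [sub_add_cancel] at h
    exact (le_div_iff₀' hθ0).2 h
  · -- two-sided decay
    simp only [hg]
    have h1 : θ ^ k.val ≤ θ ^ j := hmono _ _ hj
    have h2 : θ ^ (M - k.val) ≤ θ ^ j := hmono _ _ (by omega)
    linarith

omit [NeZero M] in
/-- Shifting by an integer `u` costs at most `θ⁻¹^{|u|}` for a profile with one-step ratios `≤ θ⁻¹`. [folklore] -/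
theorem profile_add_int_le {θ : ℝ} (hθ0 : 0 < θ) {G : ZMod M → ℝ}
    (hup : ∀ k, G (k + 1) ≤ θ⁻¹ * G k) (hdn : ∀ k, G (k - 1) ≤ θ⁻¹ * G k) (k : ZMod M) (u : ℤ) :
    G (k + u) ≤ θ⁻¹ ^ u.natAbs * G k := by
  have hnat : ∀ (m : ℕ) (k : ZMod M), G (k + m) ≤ θ⁻¹ ^ m * G k := by
    intro m
    induction m with
    | zero => intro k; simp
    | succ m ih =>
      intro k
      have e : k + ((m + 1 : ℕ) : ZMod M) = (k + m) + 1 := by push_cast; ring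
      rw [e, pow_succ]
      calc G (k + m + 1) ≤ θ⁻¹ * G (k + m) := hup _
        _ ≤ θ⁻¹ * (θ⁻¹ ^ m * G k) := mul_le_mul_of_nonneg_left (ih k) (inv_nonneg.2 hθ0.le)
        _ = θ⁻¹ ^ m * θ⁻¹ * G k := by ring
  have hneg : ∀ (m : ℕ) (k : ZMod M), G (k - m) ≤ θ⁻¹ ^ m * G k := by
    intro m
    induction m with
    | zero => intro k; simp
    | succ m ih =>
      intro k
      have e : k - ((m + 1 : ℕ) : ZMod M) = (k - m) - 1 := by push_cast; ring
      rw [e, pow_succ]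
      calc G (k - m - 1) ≤ θ⁻¹ * G (k - m) := hdn _
        _ ≤ θ⁻¹ * (θ⁻¹ ^ m * G k) := mul_le_mul_of_nonneg_left (ih k) (inv_nonneg.2 hθ0.le)
        _ = θ⁻¹ ^ m * θ⁻¹ * G k := by ring
  obtain ⟨m, hm | hm⟩ := Int.eq_nat_or_neg u
  · subst hm
    rw [Int.natAbs_natCast, Int.cast_natCast]
    exact hnat m k
  · subst hm
    rw [Int.natAbs_neg, Int.natAbs_natCast, Int.cast_neg, Int.cast_natCast, ← sub_eq_add_neg]
    exact hneg m k

/-- Decay of the two-sided profile at an INTEGER representative: `g(K mod M) ≤ 2θ^j` if `j ≤ |K| ≤ M − j`. [folklore] -/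
theorem profile_intCast_le {θ : ℝ} {g : ZMod M → ℝ}
    (hdec : ∀ (k : ZMod M) (j : ℕ), j ≤ k.val → j + k.val ≤ M → g k ≤ 2 * θ ^ j)
    {K : ℤ} {j : ℕ} (hj : (j : ℤ) ≤ |K|) (hjK : (j : ℤ) + |K| ≤ M) : g (K : ZMod M) ≤ 2 * θ ^ j := by
  have hval : (((K : ZMod M)).val : ℤ) = K % (M : ℤ) := ZMod.val_intCast K
  have hMpos : (0 : ℤ) < M := by have := NeZero.pos M; exact_mod_cast this
  rcases le_or_gt 0 K with hK0 | hK0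
  · rw [abs_of_nonneg hK0] at hj hjK
    rcases lt_or_eq_of_le (show K ≤ M by linarith) with hKM | hKM
    · have hv : (((K : ZMod M)).val : ℤ) = K := by rw [hval, Int.emod_eq_of_lt hK0 hKM]
      exact hdec _ j (by omega) (by omega)
    · -- `K = M`: the cast is `0`
      have hj0 : j = 0 := by omega
      have hv : (((K : ZMod M)).val : ℤ) = 0 := by rw [hval, hKM]; simp
      exact hdec _ j (by omega) (by have := ZMod.val_lt (K : ZMod M); omega)
  · rw [abs_of_neg hK0] at hj hjK
    rcases lt_or_eq_of_le (show -(M : ℤ) ≤ K by linarith) with hKM | hKM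
    · have hv : (((K : ZMod M)).val : ℤ) = K + M := by
        rw [hval, ← Int.add_emod_right K M, Int.emod_eq_of_lt (by linarith) (by linarith)]
      exact hdec _ j (by omega) (by omega)
    · have hv : (((K : ZMod M)).val : ℤ) = 0 := by
        rw [hval, ← hKM]; simp
      exact hdec _ j (by omega) (by have := ZMod.val_lt (K : ZMod M); omega)

end Cycle

/-! ### Torus coordinates: from the cyclic distance of the `i`-coordinates to the doubled coordinates -/

section Coordinates

variable {d L : ℕ} [NeZero L]

/-- If the cyclic distance of `a, b ∈ ℤ/L` is `≥ n`, the integer `δ = val a − val b` satisfies `n ≤ |δ|` and `n + |δ| ≤ L`. [folklore] -/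
theorem le_abs_val_sub_of_le_valMinAbs {a b : ZMod L} {n : ℕ} (h : n ≤ ((a - b).valMinAbs).natAbs) :
    (n : ℤ) ≤ |((a.val : ℤ) - b.val)| ∧ (n : ℤ) + |((a.val : ℤ) - b.val)| ≤ L := by
  set δ : ℤ := (a.val : ℤ) - b.val with hδ
  have hcast : ((δ : ℤ) : ZMod L) = a - b := by simp [hδ]
  have hva : (a.val : ℤ) < L := by exact_mod_cast ZMod.val_lt a
  have hvb : (b.val : ℤ) < L := by exact_mod_cast ZMod.val_lt b
  have ha0 : (0 : ℤ) ≤ a.val := by positivity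
  have hb0 : (0 : ℤ) ≤ b.val := by positivity
  have hmin : ∀ y : ℤ, ((y : ℤ) : ZMod L) = a - b → (((a - b).valMinAbs).natAbs : ℤ) ≤ |y| := by
    intro y hy
    have h1 := ZMod.natAbs_min_of_le_div_two L ((a - b).valMinAbs) y (by rw [ZMod.coe_valMinAbs, hy])
      (ZMod.natAbs_valMinAbs_le _)
    rw [← Int.natCast_natAbs y]; exact_mod_cast h1
  have hn : (n : ℤ) ≤ (((a - b).valMinAbs).natAbs : ℤ) := by exact_mod_cast h
  refine ⟨hn.trans (hmin δ hcast), ?_⟩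
  -- the shifted representative `δ ∓ L`
  rcases le_or_gt 0 δ with hδ0 | hδ0
  · have h2 := hmin (δ - L) (by rw [Int.cast_sub, hcast]; simp)
    rw [abs_of_nonneg hδ0]
    rw [abs_of_nonpos (by linarith)] at h2
    linarith
  · have h2 := hmin (δ + L) (by rw [Int.cast_add, hcast]; simp)
    rw [abs_of_neg hδ0]
    rw [abs_of_nonneg (by linarith)] at h2
    linarith

omit [NeZero L] in
/-- The doubled coordinate difference of two links is the cast of the integer `2(val x_i − val y_i) + ([dir x = i] − [dir y = i])`. [folklore] -/
theorem hc_sub_eq_intCast (x y : Edge d L) (i : Fin d) :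
    (((2 * (x.1 i).val : ℕ) : ZMod (2 * L)) + (if x.2 = i then 1 else 0)) -
        (((2 * (y.1 i).val : ℕ) : ZMod (2 * L)) + (if y.2 = i then 1 else 0)) =
      ((2 * (((x.1 i).val : ℤ) - (y.1 i).val) + ((if x.2 = i then 1 else 0) - (if y.2 = i then 1 else 0)) : ℤ) :
        ZMod (2 * L)) := by
  push_cast
  split_ifs <;> ring

/-- If two links are within torus distance `r'`, their doubled `i`-coordinates differ by the cast of an integer `u` with `|u| ≤ 2r' + 1`. [folklore] -/
theorem exists_hc_eq_add_of_torusNorm_le {x z : Edge d L} {i : Fin d} {r' : ℕ} (h : torusNorm (x.1 - z.1) ≤ r') :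
    ∃ u : ℤ, u.natAbs ≤ 2 * r' + 1 ∧
      (((2 * (z.1 i).val : ℕ) : ZMod (2 * L)) + (if z.2 = i then 1 else 0)) =
        (((2 * (x.1 i).val : ℕ) : ZMod (2 * L)) + (if x.2 = i then 1 else 0)) + (u : ZMod (2 * L)) := by
  set t : ℤ := (z.1 i - x.1 i).valMinAbs with ht
  have htn : t.natAbs ≤ r' := by
    have h1 := natAbs_valMinAbs_le_torusNorm (x.1 - z.1) i
    rw [Pi.sub_apply] at h1
    have h2 : ((z.1 i - x.1 i).valMinAbs).natAbs = ((x.1 i - z.1 i).valMinAbs).natAbs := by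
      rw [← neg_sub, ZMod.natAbs_valMinAbs_neg]
    rw [ht, h2]; exact h1.trans h
  -- `t ≡ val z_i − val x_i (mod L)`, hence `2t ≡ 2(val z_i − val x_i) (mod 2L)`
  have hmod : ((2 * t : ℤ) : ZMod (2 * L)) = ((2 * (((z.1 i).val : ℤ) - (x.1 i).val) : ℤ) : ZMod (2 * L)) := by
    rw [ZMod.intCast_eq_intCast_iff_dvd_sub]
    have h1 : ((L : ℕ) : ℤ) ∣ (((z.1 i).val : ℤ) - (x.1 i).val) - t := by
      rw [← ZMod.intCast_eq_intCast_iff_dvd_sub]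
      rw [ht, ZMod.coe_valMinAbs]; push_cast; simp
    have h2 := mul_dvd_mul_left (2 : ℤ) h1
    have e : (2 : ℤ) * (((z.1 i).val : ℤ) - (x.1 i).val) - 2 * t = 2 * ((((z.1 i).val : ℤ) - (x.1 i).val) - t) := by ring
    push_cast
    rw [e]; exact h2
  refine ⟨2 * t + ((if z.2 = i then 1 else 0) - (if x.2 = i then 1 else 0)), ?_, ?_⟩
  · have : ((if z.2 = i then 1 else 0) - (if x.2 = i then 1 else 0) : ℤ).natAbs ≤ 1 := by split_ifs <;> simp
    calc (2 * t + ((if z.2 = i then 1 else 0) - (if x.2 = i then 1 else 0))).natAbs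
        ≤ (2 * t).natAbs + ((if z.2 = i then 1 else 0) - (if x.2 = i then 1 else 0) : ℤ).natAbs := Int.natAbs_add_le _ _
      _ ≤ 2 * r' + 1 := by rw [Int.natAbs_mul]; simp; omega
  · rw [Int.cast_add, hmod]
    push_cast
    split_ifs <;> ring

end Coordinates

end Summit.Ventures.YMGap.RobustBall.TorusAxis

end
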